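import Mathlib
import Summits.Ventures.PercRepro2.Defs
import Summits.Ventures.PercRepro2.Independence
import Summits.Ventures.PercRepro2.Harris
import Summits.Ventures.PercRepro2.Graph
import Summits.Ventures.PercRepro2.Events
import Summits.Ventures.PercRepro2.ZCLeafBuilt
import Summits.Ventures.PercRepro2.ZCForest
import Summits.Ventures.PercRepro2.ZCA3WGraph
import Summits.Ventures.PercRepro2.ZCOWGraph
import Summits.Ventures.PercRepro2.ZCRootWGraph
import Summits.Ventures.PercRepro2.ZCRootOWGraph

/-!
# (ZC) on a forest plus one degree-two mark — Theorems E, F, G, H composed with the forest theorem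
(blind cell PercRepro2, mine-a g24; MINE-A.md §72.7)

If a mark `v ∈ {a₁, a₃, o}` has exactly the two edges `f₁`, `f₂` (to a second mark and to any vertex `w`,
in one of the four placements of Theorems E, F, G, H) and the remaining positive-weight edges form a
simple forest, then (ZC) holds for every weight vector and every cluster up-set.  The graph `G` itself
may contain a cycle (through `v`), so these are the first kernel statements about (ZC) on infinite
families of non-forests: every unicyclic graph whose cycle carries such a mark, every forest with one
extra vertex of degree two in a mark's role, etc.

Each theorem is the graph instance of the reduction (`zc_a3w_graph`, `zc_rootw_graph`, `zc_ow_graph`,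
`zc_rootow_graph`) followed by `zc_of_forest_support` for the reduced weights `p[f₁, f₂ ↦ 0]`.
One seat.
-/

namespace Summit.Ventures.PercRepro2

section InsertForest

variable {V : Type*} [Fintype V] [DecidableEq V] {E : Type*} [Fintype E] [DecidableEq E]
  {R : Type*} [CommRing R] [LinearOrder R] [IsStrictOrderedRing R]

omit [Fintype E] [LinearOrder R] [IsStrictOrderedRing R] in
/-- The weights with `f₁`, `f₂` removed: their support is `{e ∣ e ≠ f₁ ∧ e ≠ f₂ ∧ p e ≠ 0}`. -/
lemma update_two_zero_ne_zero_iff (p : E → R) (f₁ f₂ e : E) :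
    Function.update (Function.update p f₁ 0) f₂ 0 e ≠ 0 ↔ e ≠ f₁ ∧ e ≠ f₂ ∧ p e ≠ 0 := by
  by_cases h2 : e = f₂
  · subst h2; simp
  · by_cases h1 : e = f₁
    · subst h1; simp [Function.update_of_ne h2]
    · simp [h1, h2]

/-- (ZC) under `p[f₁, f₂ ↦ 0]` for all marks and up-sets when the remaining positive-weight edges form
a simple forest. -/
lemma zc_reduced_of_forest {ends : E → Sym2 V} (p : E → R) (hp : IsProbVec p) (f₁ f₂ : E)
    (hloop : ∀ e, e ≠ f₁ → e ≠ f₂ → p e ≠ 0 → ¬ (ends e).IsDiag)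
    (hinj : ∀ e e', e ≠ f₁ → e ≠ f₂ → p e ≠ 0 → e' ≠ f₁ → e' ≠ f₂ → p e' ≠ 0 → ends e = ends e' → e = e')
    (hacyc : (openGraph ends (fun e => decide (e ≠ f₁ ∧ e ≠ f₂ ∧ p e ≠ 0))).IsAcyclic)
    (a₁ a₃ o : V) (𝓔 : Set (Set V)) (h𝓔 : IsUpperSet 𝓔) :
    let p' := Function.update (Function.update p f₁ 0) f₂ 0
    let e := connEvent ends a₁ a₃
    let L' := connEvent ends a₁ o
    let U := clusterInEvent ends a₁ 𝓔
    let γ := connEvent ends a₃ o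
    0 ≤ prob p' (eᶜ ∩ L'ᶜ ∩ γᶜ) * (prob p' (U ∩ (e ∩ L')) - prob p' U * prob p' (e ∩ L'))
      - prob p' (eᶜ ∩ L'ᶜ ∩ γ) * (prob p' (U ∩ (e ∩ L'ᶜ)) - prob p' U * prob p' (e ∩ L'ᶜ)) := by
  intro p' e L' U γ
  have hp' : IsProbVec p' := (hp.update f₁ le_rfl zero_le_one).update f₂ le_rfl zero_le_one
  have hsupp : ∀ e, p' e ≠ 0 ↔ e ≠ f₁ ∧ e ≠ f₂ ∧ p e ≠ 0 := update_two_zero_ne_zero_iff p f₁ f₂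
  have hconf : (fun e => decide (p' e ≠ 0)) = fun e => decide (e ≠ f₁ ∧ e ≠ f₂ ∧ p e ≠ 0) := by
    funext e; simp only [hsupp]
  refine zc_of_forest_support ends p' hp' (fun e he => ?_) (fun e e' he he' h => ?_) ?_ a₁ a₃ o 𝓔 h𝓔
  · obtain ⟨h1, h2, h3⟩ := (hsupp e).1 he
    exact hloop e h1 h2 h3
  · obtain ⟨h1, h2, h3⟩ := (hsupp e).1 he
    obtain ⟨h1', h2', h3'⟩ := (hsupp e').1 he'
    exact hinj e e' h1 h2 h3 h1' h2' h3' h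
  · rw [hconf]; exact hacyc

/-- **Theorem E + forest**: `a₃` joined to the rest only by `f₁ = a₃a₁`, `f₂ = a₃w`, the other
positive-weight edges a simple forest ⇒ (ZC) for every up-set. -/
theorem zc_a3w_of_forest {p : E → R} (hp : IsProbVec p) {ends : E → Sym2 V} {a₁ a₃ o w : V}
    {f₁ f₂ : E} (hf : f₁ ≠ f₂) (hends₁ : ends f₁ = s(a₃, a₁)) (hends₂ : ends f₂ = s(a₃, w))
    (hmark : ∀ e, a₃ ∈ ends e → e = f₁ ∨ e = f₂) (h31 : a₃ ≠ a₁) (h3o : a₃ ≠ o)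
    (hloop : ∀ e, e ≠ f₁ → e ≠ f₂ → p e ≠ 0 → ¬ (ends e).IsDiag)
    (hinj : ∀ e e', e ≠ f₁ → e ≠ f₂ → p e ≠ 0 → e' ≠ f₁ → e' ≠ f₂ → p e' ≠ 0 → ends e = ends e' → e = e')
    (hacyc : (openGraph ends (fun e => decide (e ≠ f₁ ∧ e ≠ f₂ ∧ p e ≠ 0))).IsAcyclic)
    {𝓔 : Set (Set V)} (h𝓔 : IsUpperSet 𝓔) :
    let e := connEvent ends a₁ a₃
    let L := connEvent ends a₁ o
    let U := clusterInEvent ends a₁ 𝓔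
    let γ := connEvent ends a₃ o
    0 ≤ prob p (eᶜ ∩ Lᶜ ∩ γᶜ) * (prob p (U ∩ (e ∩ L)) - prob p U * prob p (e ∩ L))
      - prob p (eᶜ ∩ Lᶜ ∩ γ) * (prob p (U ∩ (e ∩ Lᶜ)) - prob p U * prob p (e ∩ Lᶜ)) :=
  zc_a3w_graph hp hf hends₁ hends₂ hmark h31 h3o h𝓔
    (zc_reduced_of_forest p hp f₁ f₂ hloop hinj hacyc a₁ w o _ (isUpperSet_rootShift h𝓔 a₃))

/-- **Theorem G + forest**: `o` joined to the rest only by `f₁ = oa₁`, `f₂ = ow`, the other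
positive-weight edges a simple forest ⇒ (ZC) for every up-set. -/
theorem zc_ow_of_forest {p : E → R} (hp : IsProbVec p) {ends : E → Sym2 V} {a₁ a₃ o w : V}
    {f₁ f₂ : E} (hf : f₁ ≠ f₂) (hends₁ : ends f₁ = s(o, a₁)) (hends₂ : ends f₂ = s(o, w))
    (hmark : ∀ e, o ∈ ends e → e = f₁ ∨ e = f₂) (ho1 : o ≠ a₁) (ho3 : o ≠ a₃)
    (hloop : ∀ e, e ≠ f₁ → e ≠ f₂ → p e ≠ 0 → ¬ (ends e).IsDiag)
    (hinj : ∀ e e', e ≠ f₁ → e ≠ f₂ → p e ≠ 0 → e' ≠ f₁ → e' ≠ f₂ → p e' ≠ 0 → ends e = ends e' → e = e')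
    (hacyc : (openGraph ends (fun e => decide (e ≠ f₁ ∧ e ≠ f₂ ∧ p e ≠ 0))).IsAcyclic)
    {𝓔 : Set (Set V)} (h𝓔 : IsUpperSet 𝓔) :
    let e := connEvent ends a₁ a₃
    let L := connEvent ends a₁ o
    let U := clusterInEvent ends a₁ 𝓔
    let γ := connEvent ends a₃ o
    0 ≤ prob p (eᶜ ∩ Lᶜ ∩ γᶜ) * (prob p (U ∩ (e ∩ L)) - prob p U * prob p (e ∩ L))
      - prob p (eᶜ ∩ Lᶜ ∩ γ) * (prob p (U ∩ (e ∩ Lᶜ)) - prob p U * prob p (e ∩ Lᶜ)) :=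
  zc_ow_graph hp hf hends₁ hends₂ hmark ho1 ho3 h𝓔
    (zc_reduced_of_forest p hp f₁ f₂ hloop hinj hacyc a₁ a₃ w _ (isUpperSet_rootShift h𝓔 o))

/-- **Theorem F + forest**: the root `a₁` joined to the rest only by `f₁ = a₁a₃`, `f₂ = a₁w`,
`{a₁} ∉ 𝓔`, the other positive-weight edges a simple forest ⇒ (ZC) for every such up-set. -/
theorem zc_rootw_of_forest {p : E → R} (hp : IsProbVec p) {ends : E → Sym2 V} {a₁ a₃ o w : V}
    {f₁ f₂ : E} (hf : f₁ ≠ f₂) (hends₁ : ends f₁ = s(a₁, a₃)) (hends₂ : ends f₂ = s(a₁, w))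
    (hroot : ∀ e, a₁ ∈ ends e → e = f₁ ∨ e = f₂) (h13 : a₁ ≠ a₃) (h1o : a₁ ≠ o)
    (hloop : ∀ e, e ≠ f₁ → e ≠ f₂ → p e ≠ 0 → ¬ (ends e).IsDiag)
    (hinj : ∀ e e', e ≠ f₁ → e ≠ f₂ → p e ≠ 0 → e' ≠ f₁ → e' ≠ f₂ → p e' ≠ 0 → ends e = ends e' → e = e')
    (hacyc : (openGraph ends (fun e => decide (e ≠ f₁ ∧ e ≠ f₂ ∧ p e ≠ 0))).IsAcyclic)
    {𝓔 : Set (Set V)} (h𝓔 : IsUpperSet 𝓔) (h𝓔₁ : ({a₁} : Set V) ∉ 𝓔) :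
    let e := connEvent ends a₁ a₃
    let L := connEvent ends a₁ o
    let U := clusterInEvent ends a₁ 𝓔
    let γ := connEvent ends a₃ o
    0 ≤ prob p (eᶜ ∩ Lᶜ ∩ γᶜ) * (prob p (U ∩ (e ∩ L)) - prob p U * prob p (e ∩ L))
      - prob p (eᶜ ∩ Lᶜ ∩ γ) * (prob p (U ∩ (e ∩ Lᶜ)) - prob p U * prob p (e ∩ Lᶜ)) :=
  zc_rootw_graph hp hf hends₁ hends₂ hroot h13 h1o h𝓔 h𝓔₁
    (zc_reduced_of_forest p hp f₁ f₂ hloop hinj hacyc w a₃ o _ (isUpperSet_rootShift h𝓔 a₁))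

/-- **Theorem H + forest**: the root `a₁` joined to the rest only by `f₁ = a₁o`, `f₂ = a₁w`,
`{a₁} ∉ 𝓔`, the other positive-weight edges a simple forest ⇒ (ZC) for every such up-set. -/
theorem zc_rootow_of_forest {p : E → R} (hp : IsProbVec p) {ends : E → Sym2 V} {a₁ a₃ o w : V}
    {f₁ f₂ : E} (hf : f₁ ≠ f₂) (hends₁ : ends f₁ = s(a₁, o)) (hends₂ : ends f₂ = s(a₁, w))
    (hroot : ∀ e, a₁ ∈ ends e → e = f₁ ∨ e = f₂) (h13 : a₁ ≠ a₃) (h1o : a₁ ≠ o)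
    (hloop : ∀ e, e ≠ f₁ → e ≠ f₂ → p e ≠ 0 → ¬ (ends e).IsDiag)
    (hinj : ∀ e e', e ≠ f₁ → e ≠ f₂ → p e ≠ 0 → e' ≠ f₁ → e' ≠ f₂ → p e' ≠ 0 → ends e = ends e' → e = e')
    (hacyc : (openGraph ends (fun e => decide (e ≠ f₁ ∧ e ≠ f₂ ∧ p e ≠ 0))).IsAcyclic)
    {𝓔 : Set (Set V)} (h𝓔 : IsUpperSet 𝓔) (h𝓔₁ : ({a₁} : Set V) ∉ 𝓔) :
    let e := connEvent ends a₁ a₃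
    let L := connEvent ends a₁ o
    let U := clusterInEvent ends a₁ 𝓔
    let γ := connEvent ends a₃ o
    0 ≤ prob p (eᶜ ∩ Lᶜ ∩ γᶜ) * (prob p (U ∩ (e ∩ L)) - prob p U * prob p (e ∩ L))
      - prob p (eᶜ ∩ Lᶜ ∩ γ) * (prob p (U ∩ (e ∩ Lᶜ)) - prob p U * prob p (e ∩ Lᶜ)) :=
  zc_rootow_graph hp hf hends₁ hends₂ hroot h13 h1o h𝓔 h𝓔₁
    (zc_reduced_of_forest p hp f₁ f₂ hloop hinj hacyc w a₃ o _ (isUpperSet_rootShift h𝓔 a₁))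

end InsertForest

end Summit.Ventures.PercRepro2
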